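import Summits.Ventures.YMGap.Thresholds.LatticeBakryEmeryProjection
import Summits.Ventures.YMGap.Thresholds.LatticeBakryEmeryLipschitz
import HarnessLib

/-!
# Venture YMGap — multi-link Bakry–Émery calculus, Part G3:
# THM(IV) for the tilted measure and the Poincaré inequality for `e^{S} dσ^{⊗E}` on `SU(N)^E`

HONEST FRAMING: venture file (cell `pub-ymgap`, track (a), seat p2). This file completes the
KERNEL proof of the **multi-link Bakry–Émery Poincaré inequality** (Bakry–Émery 1985;
Bakry–Gentil–Ledoux Prop. 4.8.1 `CD(K,∞) ⇒ Poincaré(1/K)`) for Gibbs measures `e^{S} dσ^{⊗E}/Z` on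
the compact group `SU(N)^E` with a smooth POLYNOMIAL potential `S` whose second derivatives along
`𝔰𝔲(N)^E` are bounded by `Λ` (`HessBound S Λ`): with `K = N/2 - Λ > 0`,

  `K ∫ e^S (u - m)² dσ^{⊗E} ≤ ∫ e^S Γ(u,u) dσ^{⊗E}`  (`poincare_gibbs`, `m` the `e^S σ^{⊗E}`-mean),

by the argument of the one-link tree file `SUNBakryEmeryPoincare.lean` ("THM(IV) for the tilted
measure"): project `w ⟂ (Δ - W)𝒫` onto the polynomial subspaces, transform by `e^{-S/2}`, and use
the Poincaré inequality of the product Haar measure (`poincare_haar`). No stochastic analysis, no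
spectral theorem, no elliptic regularity. Lipschitz form (`poincare_gibbs_lipschitz`, Shen–Zhu–Zhu
(4.11)/(4.13) with `K_S` replaced by `K = N/2 - Λ`): `K ∫ e^S (u - m)² dσ^{⊗E} ≤ (∑_e L_e²) ∫ e^S dσ^{⊗E}`
for `u` smooth and `L_e`-Lipschitz in each link. The Wilson action of lattice Yang–Mills is such an
`S` (downstream file), with `Λ = 4dN|β|` by the venture's kernel theorem "Hessian ≤ 4d".

## References

* D. Bakry, M. Émery, LNM 1123 (1985) 177–206; D. Bakry, I. Gentil, M. Ledoux, Grundlehren 348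
  (2014), Prop. 4.8.1.
* H. Shen, R. Zhu, X. Zhu, CMP 400 (2023) 805–851, Theorem 4.2 / (4.6)–(4.8) (the lattice instance).
* Tree file `SUNBakryEmeryPoincare.lean`, Part G.
-/

noncomputable section

open scoped Matrix ComplexConjugate BigOperators Matrix.Norms.Frobenius ContDiff Topology InnerProductSpace
open Matrix Complex Finset MeasureTheory Filter
open Literature.MathematicalPhysics.QuantumFieldTheory

namespace Summit.Ventures.YMGap

namespace LatticeBakryEmery

universe u

variable {ι : Type u} [Fintype ι] [DecidableEq ι] {N : ℕ}

/-- **THM(IV)_S**: if `w ∈ L²(σ^{⊗E})` is orthogonal to `(Δ - W)p` for all polynomials `p`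
(`W = ¼Γ(S,S) + ½ΔS`, `S ∈ 𝒫_d`), then `w = m e^{S/2}` a.e. — the ground state is the only `L²`
solution of the Schrödinger equation (project, transform by `e^{-S/2}`, use `poincare_haar`). -/
theorem ae_eq_groundState_of_orthogonal (hN : N ≠ 0) {dS : ℕ} {S : Cfg ι N → ℝ} (hSp : S ∈ polySpace ι N dS)
    (w : Lp ℝ 2 (haarPi ι N))
    (hw : ∀ n, ∀ p ∈ polySpace ι N n,
      ∫ g : PSU ι N, w g * (Lap p (emb g) - schW S (emb g) * p (emb g)) ∂(haarPi ι N) = 0) :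
    ∃ m : ℝ, (fun g => w g) =ᵐ[haarPi ι N] fun g => m * Real.exp (S (emb g) / 2) := by
  have hS : ContDiff ℝ ∞ S := contDiff_of_mem_polySpace hSp
  have hSc : Continuous fun g : PSU ι N => S (emb g) := continuous_restrict hS
  obtain ⟨p, hp, hconv, hbd, hid⟩ := exists_proj_seq hN hSp w hw
  have hpc : ∀ n, ContDiff ℝ ∞ (p n) := fun n => contDiff_of_mem_polySpace (hp n)
  -- bounds on `e^{-S}` and `W` over the compact group
  obtain ⟨CS, hCS⟩ : ∃ C, ∀ g : PSU ι N, Real.exp (-S (emb g)) ≤ C := by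
    obtain ⟨C, hC⟩ := (isCompact_univ (X := PSU ι N)).exists_bound_of_continuousOn
      ((Real.continuous_exp.comp hSc.neg).continuousOn)
    exact ⟨C, fun g => (Real.le_norm_self _).trans (hC g (Set.mem_univ _))⟩
  have hCS0 : 0 ≤ CS := (Real.exp_pos _).le.trans (hCS 1)
  obtain ⟨CW, hCW⟩ : ∃ C, ∀ g : PSU ι N, |schW S (emb g)| ≤ C := by
    obtain ⟨C, hC⟩ := (isCompact_univ (X := PSU ι N)).exists_bound_of_continuousOn
      ((continuous_restrict (contDiff_schW hS)).continuousOn)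
    exact ⟨C, fun g => (hC g (Set.mem_univ _))⟩
  have hCW0 : 0 ≤ CW := (abs_nonneg _).trans (hCW 1)
  -- the transformed projections
  set q : ℕ → Cfg ι N → ℝ := fun n Q => Real.exp (-S Q / 2) * p n Q with hqdef
  have hq : ∀ n, ContDiff ℝ ∞ (q n) := fun n => contDiff_groundState hS (hpc n)
  -- (d) the ground-state identity, integrated
  have hd : ∀ n, ∫ g : PSU ι N, Real.exp (S (emb g)) * Gam (q n) (q n) (emb g) ∂(haarPi ι N) =
      ∫ g : PSU ι N, Gam (p n) (p n) (emb g) ∂(haarPi ι N) +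
        ∫ g : PSU ι N, schW S (emb g) * p n (emb g) ^ 2 ∂(haarPi ι N) := by
    intro n
    have hpn := hpc n
    have h1 : ∫ g : PSU ι N, p n (emb g) ^ 2 * Lap S (emb g) ∂(haarPi ι N) =
        -∫ g : PSU ι N, 2 * (p n (emb g) * Gam S (p n) (emb g)) ∂(haarPi ι N) := by
      have h := integral_mul_Lap hN (F := fun Q => p n Q * p n Q) (hpn.mul hpn) hS
      have e : ∀ g : PSU ι N, Gam (fun Q => p n Q * p n Q) S (emb g) = 2 * (p n (emb g) * Gam S (p n) (emb g)) :=
        fun g => by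
          show Gam (p n * p n) S (emb g) = _
          rw [Gam_mul_left (F := p n) (G := p n) hpn hpn, Gam_comm (p n) S]; ring
      simp only [e] at h
      rw [← h]
      exact integral_congr_ae (ae_of_all _ fun g => by ring)
    have i1 : Integrable (fun g : PSU ι N => Gam (p n) (p n) (emb g)) (haarPi ι N) :=
      integrable_of_continuous_PSU (continuous_restrict (contDiff_Gam hpn hpn)) _
    have i2 : Integrable (fun g : PSU ι N => p n (emb g) * Gam S (p n) (emb g)) (haarPi ι N) :=
      integrable_of_continuous_PSU ((continuous_restrict hpn).mul (continuous_restrict (contDiff_Gam hS hpn))) _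
    have i3 : Integrable (fun g : PSU ι N => 1 / 4 * p n (emb g) ^ 2 * Gam S S (emb g)) (haarPi ι N) :=
      integrable_of_continuous_PSU ((continuous_const.mul ((continuous_restrict hpn).pow 2)).mul
        (continuous_restrict (contDiff_Gam hS hS))) _
    have i4 : Integrable (fun g : PSU ι N => p n (emb g) ^ 2 * Lap S (emb g)) (haarPi ι N) :=
      integrable_of_continuous_PSU (((continuous_restrict hpn).pow 2).mul (continuous_restrict (contDiff_Lap hS))) _
    have i12 : Integrable (fun g : PSU ι N => Gam (p n) (p n) (emb g) - p n (emb g) * Gam S (p n) (emb g)) (haarPi ι N) :=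
      i1.sub i2
    calc ∫ g : PSU ι N, Real.exp (S (emb g)) * Gam (q n) (q n) (emb g) ∂(haarPi ι N)
        = ∫ g : PSU ι N, (Gam (p n) (p n) (emb g) - p n (emb g) * Gam S (p n) (emb g) +
            1 / 4 * p n (emb g) ^ 2 * Gam S S (emb g)) ∂(haarPi ι N) :=
          integral_congr_ae (ae_of_all _ fun g => exp_mul_Gam_groundState hS hpn _)
      _ = ∫ g : PSU ι N, Gam (p n) (p n) (emb g) ∂(haarPi ι N) -
            ∫ g : PSU ι N, p n (emb g) * Gam S (p n) (emb g) ∂(haarPi ι N) +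
            ∫ g : PSU ι N, 1 / 4 * p n (emb g) ^ 2 * Gam S S (emb g) ∂(haarPi ι N) := by
          rw [integral_add i12 i3, integral_sub i1 i2]
      _ = ∫ g : PSU ι N, Gam (p n) (p n) (emb g) ∂(haarPi ι N) +
            ∫ g : PSU ι N, schW S (emb g) * p n (emb g) ^ 2 ∂(haarPi ι N) := by
          have e2 : ∫ g : PSU ι N, p n (emb g) * Gam S (p n) (emb g) ∂(haarPi ι N) =
              -(1 / 2) * ∫ g : PSU ι N, p n (emb g) ^ 2 * Lap S (emb g) ∂(haarPi ι N) := by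
            rw [h1, integral_const_mul]; ring
          have e3 : ∫ g : PSU ι N, schW S (emb g) * p n (emb g) ^ 2 ∂(haarPi ι N) =
              ∫ g : PSU ι N, 1 / 4 * p n (emb g) ^ 2 * Gam S S (emb g) ∂(haarPi ι N) +
                (1 / 2) * ∫ g : PSU ι N, p n (emb g) ^ 2 * Lap S (emb g) ∂(haarPi ι N) := by
            rw [← integral_const_mul, ← integral_add i3 (i4.const_mul _)]
            refine integral_congr_ae (ae_of_all _ fun g => ?_)
            simp only [schW]
            ring
          rw [e2, e3]; ring
  -- (e)+(f): it tends to zero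
  have hT0 : ∀ n, 0 ≤ ∫ g : PSU ι N, Real.exp (S (emb g)) * Gam (q n) (q n) (emb g) ∂(haarPi ι N) := fun n =>
    integral_nonneg fun g => mul_nonneg (Real.exp_pos _).le (Gam_self_nonneg _ _)
  have hTle : ∀ n, ∫ g : PSU ι N, Real.exp (S (emb g)) * Gam (q n) (q n) (emb g) ∂(haarPi ι N) ≤
      CW * ‖w‖ * Real.sqrt (∫ g : PSU ι N, (p n (emb g) - w g) ^ 2 ∂(haarPi ι N)) := by
    intro n
    have hpn := hpc n
    set φ : C(PSU ι N, ℝ) := resCM (fun Q => schW S Q * p n Q)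
      (continuous_restrict ((contDiff_schW hS).mul hpn)) with hφ
    set x : Lp ℝ 2 (haarPi ι N) := toL2 ι N (resPoly n ⟨p n, hp n⟩) - w with hx
    have hWp : ∫ g : PSU ι N, schW S (emb g) * p n (emb g) ^ 2 ∂(haarPi ι N) -
        ∫ g : PSU ι N, w g * (schW S (emb g) * p n (emb g)) ∂(haarPi ι N)
        = ∫ g : PSU ι N, φ g * x g ∂(haarPi ι N) := by
      have i1 : Integrable (fun g : PSU ι N => schW S (emb g) * p n (emb g) ^ 2) (haarPi ι N) :=
        integrable_of_continuous_PSU ((continuous_restrict (contDiff_schW hS)).mul ((continuous_restrict hpn).pow 2)) _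
      have i2 : Integrable (fun g : PSU ι N => w g * (schW S (emb g) * p n (emb g))) (haarPi ι N) := by
        have := integrable_continuous_mul_L2 ((continuous_restrict (contDiff_schW hS)).mul (continuous_restrict hpn)) w
        exact this.congr (ae_of_all _ fun g => mul_comm _ _)
      rw [← integral_sub i1 i2]
      refine integral_congr_ae ?_
      filter_upwards [Lp.coeFn_sub (toL2 ι N (resPoly n ⟨p n, hp n⟩)) w,
        ContinuousMap.coeFn_toLp (p := 2) (μ := haarPi ι N) (𝕜 := ℝ) (resPoly n ⟨p n, hp n⟩)] with g hsub hres
      rw [hx, hsub, Pi.sub_apply, hres, resPoly_apply, hφ]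
      simp only [resCM, ContinuousMap.coe_mk]
      ring
    have hcs := abs_integral_mul_L2_le φ x
    have hφbd : Real.sqrt (∫ g : PSU ι N, φ g ^ 2 ∂(haarPi ι N)) ≤ CW * ‖w‖ := by
      have h2 : ∫ g : PSU ι N, φ g ^ 2 ∂(haarPi ι N) ≤ CW ^ 2 * ∫ g : PSU ι N, p n (emb g) ^ 2 ∂(haarPi ι N) := by
        rw [← integral_const_mul]
        refine integral_mono (integrable_of_continuous_PSU (φ.continuous.pow 2) _)
          ((integrable_of_continuous_PSU ((continuous_restrict hpn).pow 2) _).const_mul _) fun g => ?_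
        simp only [hφ, resCM, ContinuousMap.coe_mk, mul_pow]
        exact mul_le_mul_of_nonneg_right (by
          rw [← sq_abs]; exact pow_le_pow_left₀ (abs_nonneg _) (hCW g) 2) (sq_nonneg _)
      calc Real.sqrt (∫ g : PSU ι N, φ g ^ 2 ∂(haarPi ι N)) ≤ Real.sqrt (CW ^ 2 * ‖w‖ ^ 2) :=
            Real.sqrt_le_sqrt (h2.trans (mul_le_mul_of_nonneg_left (hbd n) (sq_nonneg _)))
        _ = CW * ‖w‖ := by rw [Real.sqrt_mul (sq_nonneg _), Real.sqrt_sq hCW0, Real.sqrt_sq (norm_nonneg _)]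
    have hxn : ‖x‖ = Real.sqrt (∫ g : PSU ι N, (p n (emb g) - w g) ^ 2 ∂(haarPi ι N)) := by
      rw [hx, ← Real.sqrt_sq (norm_nonneg (toL2 ι N (resPoly n ⟨p n, hp n⟩) - w)), norm_toL2_sub_sq]; rfl
    rw [hd n, hid n]
    calc -∫ g : PSU ι N, w g * (schW S (emb g) * p n (emb g)) ∂(haarPi ι N) +
          ∫ g : PSU ι N, schW S (emb g) * p n (emb g) ^ 2 ∂(haarPi ι N)
        = ∫ g : PSU ι N, φ g * x g ∂(haarPi ι N) := by rw [← hWp]; ring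
      _ ≤ |∫ g : PSU ι N, φ g * x g ∂(haarPi ι N)| := le_abs_self _
      _ ≤ Real.sqrt (∫ g : PSU ι N, φ g ^ 2 ∂(haarPi ι N)) * ‖x‖ := hcs
      _ ≤ CW * ‖w‖ * Real.sqrt (∫ g : PSU ι N, (p n (emb g) - w g) ^ 2 ∂(haarPi ι N)) := by
          rw [hxn]; exact mul_le_mul_of_nonneg_right hφbd (Real.sqrt_nonneg _)
  have hTlim : Tendsto (fun n => ∫ g : PSU ι N, Real.exp (S (emb g)) * Gam (q n) (q n) (emb g) ∂(haarPi ι N))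
      atTop (𝓝 0) := by
    have hup : Tendsto (fun n => CW * ‖w‖ * Real.sqrt (∫ g : PSU ι N, (p n (emb g) - w g) ^ 2 ∂(haarPi ι N)))
        atTop (𝓝 0) := by
      have := ((Real.continuous_sqrt.tendsto 0).comp hconv).const_mul (CW * ‖w‖)
      simpa using this
    exact tendsto_of_tendsto_of_tendsto_of_le_of_le tendsto_const_nhds hup hT0 hTle
  -- (g) Poincaré for the Haar measure applied to `q n`
  set μn : ℕ → ℝ := fun n => ∫ g : PSU ι N, q n (emb g) ∂(haarPi ι N) with hμn
  have hD : Tendsto (fun n => ∫ g : PSU ι N, (q n (emb g) - μn n) ^ 2 ∂(haarPi ι N)) atTop (𝓝 0) := by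
    have hN2 : 0 < (N : ℝ) / 2 := div_pos (Nat.cast_pos.2 (Nat.pos_of_ne_zero hN)) two_pos
    have hle : ∀ n, ∫ g : PSU ι N, (q n (emb g) - μn n) ^ 2 ∂(haarPi ι N) ≤
        (2 / N * CS) * ∫ g : PSU ι N, Real.exp (S (emb g)) * Gam (q n) (q n) (emb g) ∂(haarPi ι N) := by
      intro n
      have h1 := poincare_haar hN (hq n)
      have h2 : ∫ g : PSU ι N, Gam (q n) (q n) (emb g) ∂(haarPi ι N) ≤
          CS * ∫ g : PSU ι N, Real.exp (S (emb g)) * Gam (q n) (q n) (emb g) ∂(haarPi ι N) := by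
        rw [← integral_const_mul]
        refine integral_mono (integrable_of_continuous_PSU (continuous_restrict (contDiff_Gam (hq n) (hq n))) _)
          ((integrable_of_continuous_PSU ((Real.continuous_exp.comp hSc).mul
            (continuous_restrict (contDiff_Gam (hq n) (hq n)))) _).const_mul _) fun g => ?_
        have hΓ := Gam_self_nonneg (q n) (emb g)
        calc Gam (q n) (q n) (emb g) = Real.exp (-S (emb g)) * (Real.exp (S (emb g)) * Gam (q n) (q n) (emb g)) := by
              rw [← mul_assoc, ← Real.exp_add, show -S (emb g) + S (emb g) = 0 by ring, Real.exp_zero, one_mul]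
          _ ≤ CS * (Real.exp (S (emb g)) * Gam (q n) (q n) (emb g)) :=
              mul_le_mul_of_nonneg_right (hCS g) (mul_nonneg (Real.exp_pos _).le hΓ)
      calc ∫ g : PSU ι N, (q n (emb g) - μn n) ^ 2 ∂(haarPi ι N)
          = (2 / N) * ((N : ℝ) / 2 * ∫ g : PSU ι N, (q n (emb g) - μn n) ^ 2 ∂(haarPi ι N)) := by
            field_simp
        _ ≤ (2 / N) * (CS * ∫ g : PSU ι N, Real.exp (S (emb g)) * Gam (q n) (q n) (emb g) ∂(haarPi ι N)) :=
            mul_le_mul_of_nonneg_left (h1.trans h2) (by positivity)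
        _ = (2 / N * CS) * ∫ g : PSU ι N, Real.exp (S (emb g)) * Gam (q n) (q n) (emb g) ∂(haarPi ι N) := by ring
    have hup : Tendsto (fun n => (2 / N * CS) * ∫ g : PSU ι N, Real.exp (S (emb g)) * Gam (q n) (q n) (emb g) ∂(haarPi ι N))
        atTop (𝓝 0) := by simpa using hTlim.const_mul (2 / N * CS)
    exact tendsto_of_tendsto_of_tendsto_of_le_of_le tendsto_const_nhds hup
      (fun n => integral_nonneg fun g => sq_nonneg _) hle
  -- (h) `q n → e^{-S/2} w` in `L²`
  set qf : PSU ι N → ℝ := fun g => Real.exp (-S (emb g) / 2) * w g with hqf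
  have hqf_mem : MemLp qf 2 (haarPi ι N) := by
    have hb : MemLp (fun g : PSU ι N => Real.exp (-S (emb g) / 2)) (⊤ : ENNReal) (haarPi ι N) := by
      have hc : Continuous fun g : PSU ι N => Real.exp (-S (emb g) / 2) :=
        Real.continuous_exp.comp (hSc.neg.div_const 2)
      obtain ⟨C, hC⟩ := (isCompact_univ (X := PSU ι N)).exists_bound_of_continuousOn hc.continuousOn
      exact memLp_top_of_bound hc.aestronglyMeasurable C (ae_of_all _ fun g => hC g (Set.mem_univ _))
    exact MemLp.mul' (Lp.memLp w) hb
  set Qf : Lp ℝ 2 (haarPi ι N) := hqf_mem.toLp qf with hQf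
  have hQf_coe : (fun g => Qf g) =ᵐ[haarPi ι N] qf := hqf_mem.coeFn_toLp
  have hQn : Tendsto (fun n => ‖toL2 ι N (resCM (q n) (continuous_restrict (hq n))) - Qf‖ ^ 2) atTop (𝓝 0) := by
    have hle : ∀ n, ‖toL2 ι N (resCM (q n) (continuous_restrict (hq n))) - Qf‖ ^ 2 ≤
        CS * ∫ g : PSU ι N, (p n (emb g) - w g) ^ 2 ∂(haarPi ι N) := by
      intro n
      rw [norm_sq_eq_integral, ← integral_const_mul]
      refine integral_mono_ae (integrable_sq_L2 _)
        ((((integrable_sq_L2 (toL2 ι N (resPoly n ⟨p n, hp n⟩) - w)).const_mul CS)).congr ?_) ?_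
      · filter_upwards [Lp.coeFn_sub (toL2 ι N (resPoly n ⟨p n, hp n⟩)) w,
          ContinuousMap.coeFn_toLp (p := 2) (μ := haarPi ι N) (𝕜 := ℝ) (resPoly n ⟨p n, hp n⟩)] with g hsub hres
        rw [hsub, Pi.sub_apply, hres, resPoly_apply]
      · filter_upwards [Lp.coeFn_sub (toL2 ι N (resCM (q n) (continuous_restrict (hq n)))) Qf, hQf_coe,
          ContinuousMap.coeFn_toLp (p := 2) (μ := haarPi ι N) (𝕜 := ℝ) (resCM (q n) (continuous_restrict (hq n)))]
          with g hsub hQ hres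
        rw [hsub, Pi.sub_apply, hQ, hres]
        simp only [resCM, ContinuousMap.coe_mk, hqdef, hqf]
        rw [← mul_sub, mul_pow]
        refine mul_le_mul_of_nonneg_right ?_ (sq_nonneg _)
        rw [← Real.exp_nat_mul]; norm_num
        rw [show (2 : ℝ) * (-S (emb g) / 2) = -S (emb g) by ring]
        exact hCS g
    have hup : Tendsto (fun n => CS * ∫ g : PSU ι N, (p n (emb g) - w g) ^ 2 ∂(haarPi ι N)) atTop (𝓝 0) := by
      simpa using hconv.const_mul CS
    exact tendsto_of_tendsto_of_tendsto_of_le_of_le tendsto_const_nhds hup (fun n => sq_nonneg _) hle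
  -- (i) the constants `μ n` converge to `Qf` in `L²`
  have hCn : Tendsto (fun n => cL ι N (μn n)) atTop (𝓝 Qf) := by
    rw [tendsto_iff_norm_sub_tendsto_zero]
    have h1 : ∀ n, ‖cL ι N (μn n) - Qf‖ ≤ Real.sqrt (∫ g : PSU ι N, (q n (emb g) - μn n) ^ 2 ∂(haarPi ι N)) +
        Real.sqrt (‖toL2 ι N (resCM (q n) (continuous_restrict (hq n))) - Qf‖ ^ 2) := by
      intro n
      have e1 : Real.sqrt (∫ g : PSU ι N, (q n (emb g) - μn n) ^ 2 ∂(haarPi ι N)) =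
          ‖toL2 ι N (resCM (q n) (continuous_restrict (hq n))) - cL ι N (μn n)‖ := by
        rw [← Real.sqrt_sq (norm_nonneg (toL2 ι N (resCM (q n) (continuous_restrict (hq n))) - cL ι N (μn n))),
          norm_toL2_sub_cL_sq]; rfl
      rw [e1, Real.sqrt_sq (norm_nonneg _), ← norm_neg (toL2 ι N _ - cL ι N (μn n)), neg_sub]
      exact norm_sub_le_norm_sub_add_norm_sub _ _ _
    have h2 : Tendsto (fun n => Real.sqrt (∫ g : PSU ι N, (q n (emb g) - μn n) ^ 2 ∂(haarPi ι N)) +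
        Real.sqrt (‖toL2 ι N (resCM (q n) (continuous_restrict (hq n))) - Qf‖ ^ 2)) atTop (𝓝 0) := by
      have := ((Real.continuous_sqrt.tendsto 0).comp hD).add ((Real.continuous_sqrt.tendsto 0).comp hQn)
      simpa using this
    exact tendsto_of_tendsto_of_tendsto_of_le_of_le tendsto_const_nhds h2 (fun n => norm_nonneg _) h1
  obtain ⟨m, hm⟩ := ae_eq_const_of_tendsto_cL Qf μn hCn
  refine ⟨m, ?_⟩
  filter_upwards [hm, hQf_coe] with g h1 h2
  have h3 : qf g = m := by rw [← h2]; exact h1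
  simp only [hqf] at h3
  calc w g = Real.exp (S (emb g) / 2) * (Real.exp (-S (emb g) / 2) * w g) := by
        rw [← mul_assoc, SUNBakryEmery.exp_half_mul_exp_neg_half, one_mul]
    _ = m * Real.exp (S (emb g) / 2) := by rw [h3, mul_comm]

/-- **The multi-link Bakry–Émery Poincaré inequality** (Bakry–Émery; BGL Prop. 4.8.1; the lattice case
of Shen–Zhu–Zhu (4.6)–(4.8)): on `SU(N)^E` with the product Haar probability measure `σ^{⊗E}`, for a
smooth polynomial potential `S ∈ 𝒫_d` with `|D_V D_V S| ≤ Λ ‖V‖²` along `𝔰𝔲(N)^E` (`HessBound S Λ`) and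
`K = N/2 - Λ > 0`, every smooth `u` satisfies
`K ∫ e^S (u - m)² dσ^{⊗E} ≤ ∫ e^S Γ(u,u) dσ^{⊗E}`, `m` the `e^S σ^{⊗E}`-mean of `u`. -/
theorem poincare_gibbs (hN : N ≠ 0) {dS : ℕ} {S : Cfg ι N → ℝ} (hSp : S ∈ polySpace ι N dS) {Λ : ℝ}
    (hHess : HessBound S Λ) (hK : 0 < (N : ℝ) / 2 - Λ) {u : Cfg ι N → ℝ} (hu : ContDiff ℝ ∞ u) :
    ((N : ℝ) / 2 - Λ) *
        ∫ g : PSU ι N, Real.exp (S (emb g)) * (u (emb g) -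
          (∫ g : PSU ι N, Real.exp (S (emb g)) * u (emb g) ∂(haarPi ι N)) /
            (∫ g : PSU ι N, Real.exp (S (emb g)) ∂(haarPi ι N))) ^ 2 ∂(haarPi ι N) ≤
      ∫ g : PSU ι N, Real.exp (S (emb g)) * Gam u u (emb g) ∂(haarPi ι N) :=
  poincare_of_thm4 hN hSp hHess hK (fun w hw => ae_eq_groundState_of_orthogonal hN hSp w hw) hu

/-! ### The Poincaré inequality in Lipschitz form -/

/-- **Multi-link Bakry–Émery Poincaré inequality, Lipschitz form** (Shen–Zhu–Zhu (4.11)/(4.13) with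
`K_S` replaced by `K = N/2 - Λ`): for a smooth polynomial potential `S ∈ 𝒫_d` with `HessBound S Λ`,
`K > 0`, and a smooth `u` that is `L_e`-Lipschitz in each link on `SU(N)^E`,
`K ∫ e^S (u - m)² dσ^{⊗E} ≤ (∑_e L_e²) ∫ e^S dσ^{⊗E}` (`m` the `e^S σ^{⊗E}`-mean of `u`). -/
theorem poincare_gibbs_lipschitz (hN : N ≠ 0) {dS : ℕ} {S : Cfg ι N → ℝ} (hSp : S ∈ polySpace ι N dS) {Λ : ℝ}
    (hHess : HessBound S Λ) (hK : 0 < (N : ℝ) / 2 - Λ) {u : Cfg ι N → ℝ} (hu : ContDiff ℝ ∞ u)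
    {L : ι → ℝ} (hL : ∀ e, 0 ≤ L e) (hLip : LinkLipschitz u L) :
    ((N : ℝ) / 2 - Λ) *
        ∫ g : PSU ι N, Real.exp (S (emb g)) * (u (emb g) -
          (∫ g : PSU ι N, Real.exp (S (emb g)) * u (emb g) ∂(haarPi ι N)) /
            (∫ g : PSU ι N, Real.exp (S (emb g)) ∂(haarPi ι N))) ^ 2 ∂(haarPi ι N) ≤
      (∑ e, L e ^ 2) * ∫ g : PSU ι N, Real.exp (S (emb g)) ∂(haarPi ι N) := by
  have hS : ContDiff ℝ ∞ S := contDiff_of_mem_polySpace hSp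
  refine (poincare_gibbs hN hSp hHess hK hu).trans ?_
  rw [← integral_const_mul]
  refine integral_mono (integrable_of_continuous_PSU (continuous_restrict (hS.exp.mul (contDiff_Gam hu hu))) _)
    ((integrable_of_continuous_PSU (continuous_restrict hS.exp) _).const_mul _) fun g => ?_
  have h := Gam_le_of_linkLipschitz hN hu hL hLip g
  have hpos := Real.exp_pos (S (emb g))
  calc Real.exp (S (emb g)) * Gam u u (emb g) ≤ Real.exp (S (emb g)) * ∑ e, L e ^ 2 :=
        mul_le_mul_of_nonneg_left h hpos.le
    _ = (∑ e, L e ^ 2) * Real.exp (S (emb g)) := mul_comm _ _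

end LatticeBakryEmery

end Summit.Ventures.YMGap
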